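import Summits.BirchSwinnertonDyer.BirchSwinnertonDyer.Theorems.Rank2Observatory2DescClCurveCertQ2
import Summits.BirchSwinnertonDyer.BirchSwinnertonDyer.Theorems.Rank2Observatory2DescClKillRowCert
import Summits.BirchSwinnertonDyer.BirchSwinnertonDyer.Theorems.Rank2Observatory2DescKillValid
import HarnessLib

/-!
# BirchSwinnertonDyer — rank ≥ 2 observatory: KERNEL-2DESC-CL Q2K — two-auxiliary-prime certificates with a kill list in VALIDITY form, part 1/3: checkers

HONEST FRAMING: per-curve certified theorems and census instruments; no claim on BSD in rank ≥ 2.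

Part 1 of 3.  The two-auxiliary-prime rows (`Rank2Observatory2DescClCurveCertQ2`, Q2: monogenic complex cubic
2-division fields whose class group is NOT cyclic) certify `rank E(ℚ) ≤ 2` by the plain count `#adm ≤ 2²` of the
sieve `adm₂`.  For 1 009 rank-2 curves of that census the sieve leaves `2³` (979 curves) or `2⁴` (30 curves)
classes (`generics/q2k/Q2K-SPEC.md`).  This layer adds a KILL LIST to the Q2 row exactly as the landed v2.5 layer
`Rank2Observatory2DescClKillRowCert` does for the one-prime rows, with the kill hypothesis in the shape-independent
VALIDITY form `TwoDescKill.KillValidAt` of `Rank2Observatory2DescKillValid` (as the E2V / SKV layers do):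

* the raw kill record is the landed `ClKill` (`U` = indices into the family `fam₂ fc cc`, `p`, `fuel`); its class
  `ClKill.cls₂`, representative coordinates `ClKill.z₂ = ∏_{j ∈ U} g_j` (power basis), `KillEntry` `ClKill.toEntry₂`
  over the family coordinates `famCoords₂` (no separate units: `noUnitCoords`), and the sieve
  `admK₂ = admKills (adm₂ fc cc) kills`;
* `ClKill.liteV₂` — the light clause (`z ≠ 0`, class non-trivial; NO prime list);
* `KillValidQ2 fc cc ks : Prop` — every listed kill is at a prime and VALID (`KillValidAt p a b c z t₁ t₂` at the
  `α`-coordinates `(t₁, t₂)` of `θ_E`), supplied per kill by ANY certificate form (`killValidAt_of_killCheck`,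
  `qkCert_sound`, `conicCert_sound`, …);
* `checkK₂ fc cc r ks` — `check₂ fc cc` clause for clause WITHOUT its count, then the light clauses of `ks` and
  FEWER THAN `2^(r+1)` classes passing `admK₂`;
* `killListCheckV_of_liteV₂`, `killValid_entries_of_killValidQ2`, `noTrivial_of_liteV₂` — the glue to the
  validity-form list certificate `killListCheckV` / `admKillsV_sound`.

New declarations only; sorry-free. [cite: Cassels1991LecturesEllipticCurves, §15] [cite: CremonaAlgorithms1997, §3.6]
-/

set_option linter.dupNamespace false

noncomputable section

open scoped Classical NumberField nonZeroDivisors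

open Literature.NumberTheory.NumberFields Polynomial Module NumberField IsDedekindDomain Ideal

namespace Summit.BirchSwinnertonDyer.BirchSwinnertonDyer.Rank2Observatory.TwoDescCl

open TwoDescCubic ClFieldCertQ2 TwoDescKill

/-! ## Kill records over the two-auxiliary-prime family -/

section Checkers

variable (fc : ClFieldCertQ2) (cc : ClCurveCertQ2)

/-- Power-basis coordinates of the members of `fam₂ fc cc`, as a `Fin`-family. [folklore] -/
def famCoords₂ : Fin (fam₂ fc cc).length → ℤ × ℤ × ℤ :=
  fun j => ((fam₂ fc cc).get j).2.2.g

/-- The class of a raw kill: the index set `U` as a `Finset` of positions in `fam₂ fc cc`. [folklore] -/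
def ClKill.cls₂ (k : ClKill) : Finset (Fin (fam₂ fc cc).length) :=
  Finset.univ.filter fun j : Fin (fam₂ fc cc).length => j.val ∈ k.U

/-- The representative of the killed class on the power basis: `z = ∏_{j ∈ U} g_j`. [folklore] -/
def ClKill.z₂ (k : ClKill) : ℤ × ℤ × ℤ :=
  prodCoords fc.a fc.b fc.c noUnitCoords (famCoords₂ fc cc) ∅ (k.cls₂ fc cc)

/-- A raw kill as a `KillEntry` over the family coordinates (the product clause then holds by `rfl`). [folklore] -/
def ClKill.toEntry₂ (k : ClKill) : KillEntry 0 (fam₂ fc cc).length :=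
  ⟨∅, k.cls₂ fc cc, k.z₂ fc cc, k.p, k.fuel⟩

/-- The kill list of a row as `KillEntry`s. [folklore] -/
def killEntries₂ (ks : List ClKill) : List (KillEntry 0 (fam₂ fc cc).length) :=
  ks.map (ClKill.toEntry₂ fc cc)

/-- **The sieve of a Q2K row**: `adm₂ fc cc` (norm-square residues, sign, valuation parities at `W₁₁, W₁₂,
W₂₁, W₂₂`) minus the killed classes. [folklore] -/
def admK₂ (ks : List ClKill) : Finset (Fin 0) → Finset (Fin (fam₂ fc cc).length) → Bool :=
  admKills (adm₂ fc cc) (killEntries₂ fc cc ks)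

/-- **Light kill clause, validity form**: `z ≠ 0` and the class is not the trivial class (NO prime list).
Computable. [folklore] -/
def ClKill.liteV₂ (k : ClKill) : Bool :=
  decide (k.z₂ fc cc ≠ ((0 : ℤ), (0 : ℤ), (0 : ℤ))) && decide (k.cls₂ fc cc ≠ ∅)

/-- **The kills of a Q2 row, validity form**: every raw kill is at a prime `p` and the quadric pair of its class
has no integer zero primitive at `p` (`TwoDescKill.KillValidAt`, at the `α`-coordinates `(t₁, t₂)` of `θ_E`).
A hypothesis of the soundness theorem, discharged kill by kill (`killValidQ2_cons`, part 3) by ANY certificate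
form. [cite: CremonaAlgorithms1997, §3.6] -/
def KillValidQ2 (ks : List ClKill) : Prop :=
  ∀ k ∈ ks, k.p.Prime ∧ KillValidAt k.p fc.a fc.b fc.c (k.z₂ fc cc) cc.t.2.1 cc.t.2.2

/-- **The two-auxiliary-prime per-curve `r`-checker with a kill list, validity form**: the clauses of
`check₂ fc cc` except its count (`Δ ≠ 0`; `F` has no root mod `pF`; `F(t) = 0`, `F′(t) = D`; `Δ(F) < 0`;
`N D ≠ 0` and `|N D| = ∏ p^e` against registry rows; the codes of `supp D`; `D ∉ W₁₁, W₁₂, W₂₁, W₂₂`; `Q > 0`;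
`famCheck₂` of the whole family; the parity certificate), then the light clauses of `ks` and FEWER THAN
`2^(r+1)` classes passing `admK₂`.  Computable; run by `decide +kernel`.
[cite: Cassels1991LecturesEllipticCurves, §15] [cite: CremonaAlgorithms1997, §3.6] -/
def checkK₂ (r : ℕ) (ks : List ClKill) : Bool :=
  decide (deltaShort cc.A cc.B cc.C ≠ 0) &&
    noRootMod cc.pF cc.A cc.B cc.C &&
    decide (cubicAtCoords fc.a fc.b fc.c cc.A cc.B cc.C cc.t = (0, 0, 0)) &&
    decide (derivAtCoords fc.a fc.b fc.c cc.A cc.B cc.t =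
      MonicCubic.mulCoords fc.a fc.b fc.c cc.D (prodPowCoords fc.a fc.b fc.c [])) &&
    decide (MonicCubic.disc cc.A cc.B cc.C < 0) &&
    decide (normFormZ fc.a fc.b fc.c cc.D.1 cc.D.2.1 cc.D.2.2 ≠ 0) &&
    decide ((normFormZ fc.a fc.b fc.c cc.D.1 cc.D.2.1 cc.D.2.2).natAbs = (cc.dn.map fun pe => pe.1 ^ pe.2).prod) &&
    (cc.dn.all fun pe => (fc.primes.any fun e => e.p == pe.1) &&
      ((fc.row pe.1).codes.all fun C' => decide (C' ∈ cc.codes) ||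
        cc.dinv.any fun ci => ci.1 == C' && invCert fc.a fc.b fc.c C' cc.D ci.2)) &&
    (cc.codes.all fun C => (fc.primes.any fun e => e.p == C.1) && decide (C ∈ (fc.row C.1).codes)) &&
    invCert fc.a fc.b fc.c fc.w₁₁ cc.D cc.dW11 && invCert fc.a fc.b fc.c fc.w₁₂ cc.D cc.dW12 &&
    invCert fc.a fc.b fc.c fc.w₂₁ cc.D cc.dW21 && invCert fc.a fc.b fc.c fc.w₂₂ cc.D cc.dW22 &&
    (cc.Q.all fun q => decide (0 < q)) &&
    ((fam₂ fc cc).all fun f => famCheck₂ fc cc.D f) &&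
    decide (∀ T : Finset (Fin (fam₂ fc cc).length), T ≠ ∅ →
      ∃ k : Fin (fc.chars.length + 5), Odd (T.filter fun j => bit₂ fc cc k j = true).card) &&
    (ks.all fun k => k.liteV₂ fc cc) &&
    decide (((Finset.univ ×ˢ Finset.univ).filter
      (fun p : Finset (Fin 0) × Finset (Fin (fam₂ fc cc).length) => admK₂ fc cc ks p.1 p.2 = true)).card <
        2 ^ (r + 1))

variable {fc cc}

/-- The light clauses and the primality of the kill primes give the validity-form list certificate
`killListCheckV` (the product clause holds by `rfl`). [folklore] -/
theorem killListCheckV_of_liteV₂ {ks : List ClKill} (hl : ∀ k ∈ ks, k.liteV₂ fc cc = true)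
    (hk : KillValidQ2 fc cc ks) :
    killListCheckV fc.a fc.b fc.c noUnitCoords (famCoords₂ fc cc) (killEntries₂ fc cc ks) = true := by
  rw [killListCheckV, List.all_eq_true]
  intro e he
  obtain ⟨k, hkm, rfl⟩ := List.mem_map.mp he
  have h := hl k hkm
  simp only [ClKill.liteV₂, Bool.and_eq_true, decide_eq_true_eq] at h
  obtain ⟨hz, -⟩ := h
  simp only [ClKill.toEntry₂, Bool.and_eq_true, decide_eq_true_eq]
  exact ⟨⟨(hk k hkm).1, rfl⟩, hz⟩

/-- The validity of every `KillEntry` of the row. [folklore] -/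
theorem killValid_entries_of_killValidQ2 {ks : List ClKill} (hk : KillValidQ2 fc cc ks) :
    ∀ e ∈ killEntries₂ fc cc ks, KillValidAt e.p fc.a fc.b fc.c e.z cc.t.2.1 cc.t.2.2 := by
  intro e he
  obtain ⟨k, hkm, rfl⟩ := List.mem_map.mp he
  exact (hk k hkm).2

/-- No listed class is the trivial class. [folklore] -/
theorem noTrivial_of_liteV₂ {ks : List ClKill} (hl : ∀ k ∈ ks, k.liteV₂ fc cc = true) :
    ((killEntries₂ fc cc ks).all fun e => !(decide (e.T = ∅) && decide (e.U = ∅))) = true := by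
  rw [List.all_eq_true]
  intro e he
  obtain ⟨k, hkm, rfl⟩ := List.mem_map.mp he
  have h := hl k hkm
  simp only [ClKill.liteV₂, Bool.and_eq_true, decide_eq_true_eq] at h
  simp [ClKill.toEntry₂, h.2]

end Checkers

end Summit.BirchSwinnertonDyer.BirchSwinnertonDyer.Rank2Observatory.TwoDescCl

end
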